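import Summits.MatrixMultiplication.MatrixMultiplication.Theorems.OutsiderSandwichPackingSlack

/-!
# Subrank of the Coppersmith–Winograd cube: `Q(cw₂^{⊠3}) ≥ 13` (any field), `≥ 14` (over `ℂ`)

Helper file for `LaserTangency` (route OutsiderSandwich), K38 Part III: the CONSTRUCTIVE side of the
packing census of `cw₂^{⊠N}` (NODE-g37/g38) at level `N = 3`.  The tree knows `Q(cw₂) = 2`,
`6 ≤ Q(cw₂^{⊠2}) ≤ 7` (`SoloInformedCwTwoSubrank`, `OutsiderSandwichPackingSlack.subrank_window`)
and, at level `3`, only the product bound `Q(cw₂^{⊠3}) ≥ Q(cw₂)·Q(cw₂^{⊠2}) = 12` against the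
Part-I ceiling `Q(cw₂^{⊠3}) ≤ 27 − 4 = 23`.  Here:

* `cwPow_three_restrictsTo_unitThirteen`, `thirteen_le_subrank_cwPow_three` — **`cw₂^{⊠3} ≥ ⟨13⟩`
  over every field**: an induced perfect matching of size `13` in the support of `T_{cw,2}^{⊠3}`
  (zeroing-out certificate, checked by `decide`; the tree's `SoloInformedCwTwoSubrank` has the
  level-`2` one).
* `cwTwo_restrictsTo_diag` — the inverse of Part II's isomorphism: **`cw₂ ≥ D` over `ℂ`**,
  `D a b c = [a,b,c pairwise distinct]` (the `S₃`-pattern tensor, cubic form `x₀x₁x₂`), with the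
  explicit matrix `N = [[2,0,0],[0,½,−i/2],[0,½,i/2]]`; so `cw₂^{⊠N}` and `D^{⊠N}` have the same
  restrictions over `ℂ`, but `D` has the better (tight, free) SUPPORT.
* `diagPow_restrictsTo_unitTensor_of_cert` — zeroing-out certificates for `D^{⊠N}`, and
  `cwPow_three_restrictsTo_unitFourteen`, `fourteen_le_subrank_cwPow_three_complex` —
  **`cw₂^{⊠3} ≥ D^{⊠3} ≥ ⟨14⟩` over `ℂ`**: a free diagonal of size `14 = 4 + 6 + 4` in
  `supp(D^{⊠3})`
  (first letters on the cyclic transversal `(0,1,2), (1,2,0), (2,0,1)`, tails a cross-free triple of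
  free diagonals of `D^{⊠2}` of sizes `4, 6, 4`).

So `13 ≤ Q_K(cw₂^{⊠3})` and `14 ≤ Q_ℂ(cw₂^{⊠3}) ≤ 23` (the census window at `N = 3`;
`14^{1/3} = 2.41` does not improve the tree's `Q̃(cw₂) ≥ √6`).  Both certificates were found by
randomized greedy search with local repair (this node, `scratch/freediag.py`); maximality is not
claimed.

Honest tag: WEAKER·INSTRUMENT (finite census data; no bearing on the exponential rates of
`LaserTangency` / `LaserMergeOptimal`).

References.
* M. Christandl, P. Vrana, J. Zuiddam, *Universal points in the asymptotic spectrum of tensors*,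
  J. Amer. Math. Soc. 36 (2023), §2.1 (subrank, zeroing out). [ChristandlVranaZuiddam2021]
* V. Strassen, *Degeneration and complexity of bilinear maps: some asymptotic spectra*, J. reine
  angew. Math. 413 (1991) 127–180, §6 (tight supports). [Strassen1991]
* A. Conner, F. Gesmundo, J. M. Landsberg, E. Ventura, *Rank and border rank of Kronecker powers of
  tensors and Strassen's laser method*, comput. complexity 31 (2022), eq. (1).
  [ConnerGesmundoLandsbergVentura2022]
* J. M. Landsberg, *Geometry and Complexity Theory*, CUP 2017, §3.4.9. [LandsbergGCT2017]
-/

set_option linter.dupNamespace false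

namespace Summit.MatrixMultiplication.MatrixMultiplication.Theorems.OutsiderSandwichCwCubeSubrank

open Literature.Computability.AlgebraicComplexity
open Literature.Barriers.MatrixMultiplication
open scoped Matrix

/-! ## 1. `cw₂^{⊠3} ≥ ⟨13⟩` over every field -/

section AnyField

universe u

variable {K : Type u} [Field K]

/-- Entries of `T_{cw,2}^{⊠N}`: the indicator of "every coordinate triple lies in the support".
[cite: ChristandlVranaZuiddam2021, §2.1] -/
theorem kroneckerPow_cwTwo_eq_ite (N : ℕ) (a b c : Fin N → Fin 3) :
    kroneckerPow (cwTensor K 2) N a b c =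
      if (∀ m, (a m = 0 ∧ b m = c m ∧ b m ≠ 0) ∨ (b m = 0 ∧ a m = c m ∧ a m ≠ 0) ∨
          (c m = 0 ∧ a m = b m ∧ a m ≠ 0)) then 1 else 0 := by
  simp only [kroneckerPow_apply, cwTensor_apply, Finset.prod_boole, Finset.mem_univ, true_implies]

/-- **Zeroing-out certificates** (restated without the tree's `Bool` wrapper so that this file only
imports Part I): word families on which the support of `T_{cw,2}^{⊠N}` induces exactly the diagonal
give `T_{cw,2}^{⊠N} ≥ ⟨s⟩`. [cite: ChristandlVranaZuiddam2021, §2.1] -/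
theorem cwPow_restrictsTo_unitTensor_of_cert {N s : ℕ} (f g h : Fin s → Fin N → Fin 3)
    (hcert : ∀ a b c : Fin s,
      (∀ m, (f a m = 0 ∧ g b m = h c m ∧ g b m ≠ 0) ∨ (g b m = 0 ∧ f a m = h c m ∧ f a m ≠ 0) ∨
          (h c m = 0 ∧ f a m = g b m ∧ f a m ≠ 0)) ↔ (a = b ∧ b = c)) :
    TensorRestrictsTo (kroneckerPow (cwTensor K 2) N) (unitTensor K s) := by
  classical
  have key : unitTensor K s = fun a b c => kroneckerPow (cwTensor K 2) N (f a) (g b) (h c) := by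
    funext a b c
    rw [kroneckerPow_cwTwo_eq_ite, unitTensor_apply]
    by_cases hd : a = b ∧ b = c
    · rw [if_pos hd, if_pos ((hcert a b c).2 hd)]
    · rw [if_neg hd, if_neg (fun hm => hd ((hcert a b c).1 hm))]
  rw [key]
  exact tensorRestrictsTo_precomp _ _ _ _

/-- **`cw₂^{⊠3} ≥ ⟨13⟩`** by zeroing out: the `13` word triples below form an induced perfect
matching in the support of `T_{cw,2}^{⊠3}` (`13³ · 3` coordinate checks, by `decide`).
[new; cite: ChristandlVranaZuiddam2021, §2.1] -/
theorem cwPow_three_restrictsTo_unitThirteen :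
    TensorRestrictsTo (kroneckerPow (cwTensor K 2) 3) (unitTensor K 13) :=
  cwPow_restrictsTo_unitTensor_of_cert
    (![ ![0, 0, 0], ![0, 0, 1], ![0, 0, 2], ![0, 1, 0], ![0, 1, 2], ![1, 1, 1],
        ![1, 1, 2], ![2, 0, 0], ![2, 0, 2], ![2, 1, 0], ![2, 1, 2], ![2, 2, 1],
        ![2, 2, 2]] : Fin 13 → Fin 3 → Fin 3)
    (![ ![1, 1, 1], ![1, 2, 1], ![1, 2, 0], ![1, 1, 2], ![2, 1, 0], ![1, 0, 0],
        ![1, 0, 2], ![2, 2, 1], ![2, 2, 2], ![0, 1, 1], ![0, 0, 2], ![2, 2, 0],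
        ![0, 2, 2]] : Fin 13 → Fin 3 → Fin 3)
    (![ ![1, 1, 1], ![1, 2, 0], ![1, 2, 2], ![1, 0, 2], ![2, 0, 2], ![0, 1, 1],
        ![0, 1, 0], ![0, 2, 1], ![0, 2, 0], ![2, 0, 1], ![2, 1, 0], ![0, 0, 1],
        ![2, 0, 0]] : Fin 13 → Fin 3 → Fin 3)
    (by decide)

/-- **`Q(cw₂^{⊠3}) ≥ 13`** over every field (product bound: `12`; Part-I ceiling: `23`). [new] -/
theorem thirteen_le_subrank_cwPow_three : 13 ≤ subrank K (kroneckerPow (cwTensor K 2) 3) :=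
  le_subrank_of_restrictsTo cwPow_three_restrictsTo_unitThirteen

end AnyField

/-! ## 2. `cw₂ ≥ D` over `ℂ` and zeroing-out certificates for `D^{⊠N}` -/

/-- Contracting `cw₂` with three covectors: the six support entries `(0,j,j), (j,0,j), (j,j,0)`,
`j = 1, 2`. [cite: ConnerGesmundoLandsbergVentura2022, eq. (1)] -/
theorem sum_cwTwo (A B C : Fin 3 → ℂ) :
    ∑ a, ∑ b, ∑ c, A a * B b * C c * cwTensor ℂ 2 a b c =
      A 0 * B 1 * C 1 + A 0 * B 2 * C 2 + A 1 * B 0 * C 1 + A 2 * B 0 * C 2 +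
        A 1 * B 1 * C 0 + A 2 * B 2 * C 0 := by
  simp [Fin.sum_univ_three, cwTensor_apply]
  ring

/-- **`cw₂ ≥ D` over `ℂ`**: `D = (N,N,N)·cw₂` with `N = [[2,0,0],[0,½,−i/2],[0,½,i/2]]`, the
inverse of the isomorphism `D ≥ cw₂` of Part II (`x₀x₁x₂` versus `3x₀(x₁²+x₂²)`).
[cite: LandsbergGCT2017, §3.4.9; folklore] -/
theorem cwTwo_restrictsTo_diag {D : Fin 3 → Fin 3 → Fin 3 → ℂ}
    (hD : ∀ a b c, D a b c = if a ≠ b ∧ b ≠ c ∧ a ≠ c then 1 else 0) :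
    TensorRestrictsTo (cwTensor ℂ 2) D := by
  refine ⟨!![(2 : ℂ), 0, 0; 0, 1/2, -Complex.I/2; 0, 1/2, Complex.I/2],
    !![(2 : ℂ), 0, 0; 0, 1/2, -Complex.I/2; 0, 1/2, Complex.I/2],
    !![(2 : ℂ), 0, 0; 0, 1/2, -Complex.I/2; 0, 1/2, Complex.I/2], fun a' b' c' => ?_⟩
  rw [sum_cwTwo, hD]
  fin_cases a' <;> fin_cases b' <;> fin_cases c' <;> simp <;> ring_nf <;> simp [Complex.I_sq] <;>
    norm_num

/-- Entries of `D^{⊠N}`: the indicator of "letters pairwise distinct in every coordinate".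
[folklore] -/
theorem kroneckerPow_diag_eq_ite {D : Fin 3 → Fin 3 → Fin 3 → ℂ}
    (hD : ∀ a b c, D a b c = if a ≠ b ∧ b ≠ c ∧ a ≠ c then 1 else 0) (N : ℕ)
    (a b c : Fin N → Fin 3) :
    kroneckerPow D N a b c =
      if (∀ m, a m ≠ b m ∧ b m ≠ c m ∧ a m ≠ c m) then 1 else 0 := by
  simp only [kroneckerPow_apply, hD, Finset.prod_boole, Finset.mem_univ, true_implies]

/-- **Zeroing-out certificates for `D^{⊠N}`**: word families on which the support of `D^{⊠N}`
induces exactly the diagonal give `D^{⊠N} ≥ ⟨s⟩`. [cite: ChristandlVranaZuiddam2021, §2.1] -/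
theorem diagPow_restrictsTo_unitTensor_of_cert {D : Fin 3 → Fin 3 → Fin 3 → ℂ}
    (hD : ∀ a b c, D a b c = if a ≠ b ∧ b ≠ c ∧ a ≠ c then 1 else 0) {N s : ℕ}
    (f g h : Fin s → Fin N → Fin 3)
    (hcert : ∀ a b c : Fin s,
      (∀ m, f a m ≠ g b m ∧ g b m ≠ h c m ∧ f a m ≠ h c m) ↔ (a = b ∧ b = c)) :
    TensorRestrictsTo (kroneckerPow D N) (unitTensor ℂ s) := by
  classical
  have key : unitTensor ℂ s = fun a b c => kroneckerPow D N (f a) (g b) (h c) := by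
    funext a b c
    rw [kroneckerPow_diag_eq_ite hD, unitTensor_apply]
    by_cases hd : a = b ∧ b = c
    · rw [if_pos hd, if_pos ((hcert a b c).2 hd)]
    · rw [if_neg hd, if_neg (fun hm => hd ((hcert a b c).1 hm))]
  rw [key]
  exact tensorRestrictsTo_precomp _ _ _ _

/-! ## 3. `cw₂^{⊠3} ≥ ⟨14⟩` over `ℂ` -/

/-- **`cw₂^{⊠3} ≥ D^{⊠3} ≥ ⟨14⟩` over `ℂ`**: a free diagonal of size `14` in `supp(D^{⊠3})`
(`14³ · 3` letter checks, by `decide`), transported along `cw₂ ≥ D`. [new; cite: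
ChristandlVranaZuiddam2021, §2.1; Strassen1991, §6] -/
theorem cwPow_three_restrictsTo_unitFourteen :
    TensorRestrictsTo (kroneckerPow (cwTensor ℂ 2) 3) (unitTensor ℂ 14) := by
  have hD : ∀ a b c : Fin 3, (fun a b c : Fin 3 => if a ≠ b ∧ b ≠ c ∧ a ≠ c then (1 : ℂ) else 0)
      a b c = if a ≠ b ∧ b ≠ c ∧ a ≠ c then 1 else 0 := fun _ _ _ => rfl
  refine ((cwTwo_restrictsTo_diag hD).kroneckerPow 3).trans
    (diagPow_restrictsTo_unitTensor_of_cert hD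
      (![ ![0, 1, 0], ![0, 1, 2], ![0, 2, 0], ![0, 2, 2], ![1, 0, 0], ![1, 0, 1],
          ![1, 1, 1], ![1, 1, 2], ![1, 2, 0], ![1, 2, 2], ![2, 0, 0], ![2, 0, 1],
          ![2, 1, 0], ![2, 1, 1]] : Fin 14 → Fin 3 → Fin 3)
      (![ ![1, 0, 1], ![1, 0, 0], ![1, 1, 1], ![1, 1, 0], ![2, 2, 1], ![2, 2, 2],
          ![2, 0, 2], ![2, 0, 0], ![2, 1, 1], ![2, 1, 0], ![0, 2, 1], ![0, 2, 2],
          ![0, 0, 1], ![0, 0, 2]] : Fin 14 → Fin 3 → Fin 3)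
      (![ ![2, 2, 2], ![2, 2, 1], ![2, 0, 2], ![2, 0, 1], ![0, 1, 2], ![0, 1, 0],
          ![0, 2, 0], ![0, 2, 1], ![0, 0, 2], ![0, 0, 1], ![1, 1, 2], ![1, 1, 0],
          ![1, 2, 2], ![1, 2, 0]] : Fin 14 → Fin 3 → Fin 3)
      (by decide))

/-- **`Q_ℂ(cw₂^{⊠3}) ≥ 14`** (Part-I ceiling `23`). [new] -/
theorem fourteen_le_subrank_cwPow_three_complex :
    14 ≤ subrank ℂ (kroneckerPow (cwTensor ℂ 2) 3) :=
  le_subrank_of_restrictsTo cwPow_three_restrictsTo_unitFourteen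

end Summit.MatrixMultiplication.MatrixMultiplication.Theorems.OutsiderSandwichCwCubeSubrank
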